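import Summits.Ventures.YMGap.Conjectures.StrongCouplingChiralLROMesonWeightAllPlanes
import Summits.Ventures.YMGap.Conjectures.StrongCouplingChiralLROSchwingerDysonSmallBeta
import HarnessLib
import HarnessLib.Audit.Tags

/-!
# Row S3 of Y3 beyond `β = 0` (4b/4): the infrared bound (IR)_{β,4} of compact lattice QED with one
# staggered fermion at EVERY `β ≥ 0`, and the `N = 1` conjunct of `SalmhoferSeilerSmallBeta` under
# lattice symmetry

Cell `pub-ymgap`, seat qcd-lit g21 (literature-prover), `bears_on: Q1` (typed node
`SalmhoferSeilerSmallBeta`).  Everything is a theorem (0 facts, 0 sorry).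

**`infraredBound_one`.**  On the even torus `(ℤ/Lℤ)^ν` (`ν ≥ 1`), for `N = 1` and EVERY `β ≥ 0`, the
conjecture's kernel `T_β = ssTwoPoint 1 ν L β 0` satisfies the mode-wise infrared bound (IR)_{β,4}:
`2(ν - C(χ))·Re T̂_β(χ) ≤ 4` and `-2(ν + C(χ))·Re T̂_β(χ) ≤ 4` for every character `χ` — Salmhofer–Seiler's
Thm. 3.21 / (3.112)–(3.113) with the SAME constant as at `β = 0` (`infraredBound_zero`), uniformly in `L`
and `β`.  Proof: the Fröhlich–Israel–Lieb–Simon chain for a general weight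
(`ComplexSpinRPWeightGaussianDomination`, `…InfraredBound`) applied to the `β`-dressed meson weight
(`…MesonWeight`), whose background weight is reflection positive for every plane
(`…MesonWeightTimePlane`, `…MesonWeightAllPlanes`: the Gaussian-corrected reflection positivity of the
one-flavour theory = Remark 4.5 at `β > 0`).  HYPOTHESES: the invariance of the meson moments
`S_β(∏σ̂^m)` under lattice translations and axis transpositions (`hT`, `hP`) — the lattice symmetries of
the periodic staggered `U(1)` theory on the symmetric torus, whose Grassmann/Haar-level proof is separate
work.

**`chiralLRO_one_of_latticeSymmetric`.**  Consequently (with the tree's Schwinger–Dyson half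
`schwingerDysonBound_smallBeta`, `K(1) = 1`, and `S(ν) < 7/20` for `ν ≥ 4`): for every `ν ≥ 4` there are
`β₀ > 0`, `c > 0`, `L₀` with `ssChiralOrder 1 ν L β ≥ c` for all `0 ≤ β < β₀` and all even `L ≥ L₀` —
the `N = 1` conjunct of the typed conjecture `SalmhoferSeilerSmallBeta`, granted the lattice symmetries.

Honest framing: finite even tori, `β ≥ 0`; `N = 1` only (for `N ≥ 2` the crossing Gaussian of Remark 4.5
has colour-off-diagonal terms and the re-weighting argument of `StaggeredGaugeGaussianCorrectedReflectionPositivity`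
does not apply termwise); nothing about the continuum or the summit's `QCD` conjunct (`SU(3)`, `N_f`
flavours, `g → 0`), which this does not touch.

## References
* [SalmhoferSeiler1991] M. Salmhofer, E. Seiler, Commun. Math. Phys. 139 (1991) 395–432, Thm. 3.21,
  (3.112)–(3.113), Thm. 4.8, Cor. 4.9, Remarks 4.5–4.6.
* [FrohlichIsraelLiebSimon1978] J. Fröhlich, R. Israel, E. H. Lieb, B. Simon, Commun. Math. Phys. 62
  (1978) 1–34.
-/

noncomputable section

open MeasureTheory Finset MvPolynomial
open scoped ComplexConjugate BigOperators ComplexOrder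
open Literature.MathematicalPhysics.QuantumLattice
open Literature.MathematicalPhysics.QuantumLattice.StrongCoupling
open Literature.MathematicalPhysics.StatisticalMechanics
open Literature.MathematicalPhysics.StatisticalMechanics.ComplexSpin
open Literature.Barriers.CriticalPhenomena.NonGibbs
open Literature.Probability.LatticeModels (TorusSite)

namespace Summit.Ventures.YMGap.Conjectures

namespace MesonWeight

open SchwingerDyson

variable {N ν L : ℕ} [NeZero L]

/-! ### Translation invariance of the two-point kernel of the weight -/

/-- **Translation-invariant moments give a translation-invariant kernel** `[σ_{x+c}σ_{y+c}]_{W_β} = [σ_xσ_y]_{W_β}`. [cite: SalmhoferSeiler1991, (3.100)] -/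
theorem twoPtWR_mesonWeight_add [LinearOrder (TorusSite ν L)] (hL : Even L) {β : ℝ}
    (hT : ∀ (c : TorusSite ν L) (m : TorusSite ν L →₀ ℕ),
      mesonMoment N ν L β (Finsupp.mapDomain (Equiv.addRight c) m) = mesonMoment N ν L β m)
    (x y c : TorusSite ν L) :
    twoPtWR N (mesonWeight N ν L β) (x + c) (y + c) = twoPtWR N (mesonWeight N ν L β) x y := by
  apply Complex.ofReal_injective
  rw [twoPtWR, twoPtWR, ← bracketW_map_map, ← bracketW_map_map, map_mesonWeight hL, map_mul, map_mul,
    map_X, map_X, map_X, map_X,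
    show (X (x + c) * X (y + c) : FieldAlg ν L) =
        monomial (Finsupp.mapDomain (Equiv.addRight c) (Finsupp.single x 1 + Finsupp.single y 1)) 1 by
      rw [Finsupp.mapDomain_add, Finsupp.mapDomain_single, Finsupp.mapDomain_single, Equiv.coe_addRight,
        X, X, monomial_mul, mul_one],
    show (X x * X y : FieldAlg ν L) = monomial (Finsupp.single x 1 + Finsupp.single y 1) 1 by
      rw [X, X, monomial_mul, mul_one],
    bracketW_mesonWeightC_monomial, bracketW_mesonWeightC_monomial, hT]

/-! ### The infrared bound at every `β ≥ 0` (`N = 1`) -/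

/-- **(IR)_{β,4} FOR COMPACT LATTICE QED WITH ONE STAGGERED FERMION, AT EVERY `β ≥ 0`, UNIFORMLY IN THE
VOLUME** (granted the lattice symmetries of the meson moments): Salmhofer–Seiler's infrared bound
(3.112)–(3.113) with the `β = 0` constant `4 = 4N`. [cite: SalmhoferSeiler1991, Thm. 3.21 with (3.112)–(3.113) and Remark 4.5] -/
theorem infraredBound_one [NeZero ν] [LinearOrder (TorusSite ν L)] (hL : Even L) {β : ℝ} (hβ : 0 ≤ β)
    (hT : ∀ (c : TorusSite ν L) (m : TorusSite ν L →₀ ℕ),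
      mesonMoment 1 ν L β (Finsupp.mapDomain (Equiv.addRight c) m) = mesonMoment 1 ν L β m)
    (hP : ∀ (i : Fin ν) (m : TorusSite ν L →₀ ℕ),
      mesonMoment 1 ν L β (Finsupp.mapDomain (axisSwap i) m) = mesonMoment 1 ν L β m)
    (χ : AddChar (TorusSite ν L) ℂ) :
    2 * ((ν : ℝ) - cosSum χ) * (kernelSymbol (fun x y => ssTwoPoint 1 ν L β 0 x y) χ).re ≤ 4 ∧
      2 * ((ν : ℝ) + cosSum χ) * (-(kernelSymbol (fun x y => ssTwoPoint 1 ν L β 0 x y) χ).re) ≤ 4 := by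
  have hL2 : 2 ≤ L := by obtain ⟨k, hk⟩ := hL; have := NeZero.ne L; omega
  have hcard : 2 ≤ Fintype.card (TorusSite ν L) := by
    rw [Fintype.card_fun, ZMod.card, Fintype.card_fin]
    calc 2 ≤ L := hL2
      _ ≤ L ^ ν := Nat.le_self_pow (NeZero.ne ν) L
  set W₀ := mesonWeight 1 ν L β with hW₀
  have hW : ∀ (i : Fin ν) (k : ZMod L), IsRPWeight i k 1 (bgWeight ν L β) :=
    fun i k => isRPWeight_bgWeight hL hβ hT hP i k
  have hbg : ∀ ε : ℤ, TruncEq 1 (gaussFactor ε 1 * bgWeight ν L β) (MvPolynomial.map Complex.ofRealHom W₀) := by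
    intro ε
    rw [hW₀, map_mesonWeight hL]
    exact truncEq_gaussFactor_mul_bgWeight hcard ε β
  have hTinv : ∀ x y c : TorusSite ν L, twoPtWR 1 W₀ (x + c) (y + c) = twoPtWR 1 W₀ x y :=
    twoPtWR_mesonWeight_add hL hT
  have h1 := twoPtWR_mode_le hL (0 : Fin ν) hcard le_rfl hW (hbg 1) hTinv χ
  have h2 := neg_twoPtWR_mode_le hL (0 : Fin ν) hcard le_rfl hW (hbg (-1)) hTinv χ
  set Z := bracketWR 1 W₀ 1 with hZdef
  have hZ : 0 < Z := bracketWR_mesonWeight_one_pos hL β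
  have hker : (fun x y => ssTwoPoint 1 ν L β 0 x y) = fun x y => ((2 * (1 : ℕ) : ℝ) ^ 2 / Z) * twoPtWR 1 W₀ x y := by
    funext x y
    rw [ssTwoPoint_eq_twoPtWR_div one_ne_zero hL]
    ring
  have hsym : (kernelSymbol (fun x y => ssTwoPoint 1 ν L β 0 x y) χ).re =
      ((2 * (1 : ℕ) : ℝ) ^ 2 / Z) * (kernelSymbol (twoPtWR 1 W₀) χ).re := by
    rw [hker, kernelSymbol_const_mul, Complex.re_ofReal_mul]
  have hc : 0 < (2 * (1 : ℕ) : ℝ) ^ 2 / Z := by positivity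
  have hkey : (2 * (1 : ℕ) : ℝ) ^ 2 / Z * (1 / (1 : ℕ) * Z) = 4 := by
    field_simp
    norm_num
  constructor
  · rw [hsym]
    calc 2 * ((ν : ℝ) - cosSum χ) * ((2 * (1 : ℕ) : ℝ) ^ 2 / Z * (kernelSymbol (twoPtWR 1 W₀) χ).re)
        = (2 * (1 : ℕ) : ℝ) ^ 2 / Z * (2 * ((ν : ℝ) - cosSum χ) * (kernelSymbol (twoPtWR 1 W₀) χ).re) := by ring
      _ ≤ (2 * (1 : ℕ) : ℝ) ^ 2 / Z * (1 / (1 : ℕ) * Z) := mul_le_mul_of_nonneg_left h1 hc.le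
      _ = 4 := hkey
  · rw [hsym]
    calc 2 * ((ν : ℝ) + cosSum χ) * -((2 * (1 : ℕ) : ℝ) ^ 2 / Z * (kernelSymbol (twoPtWR 1 W₀) χ).re)
        = (2 * (1 : ℕ) : ℝ) ^ 2 / Z * (2 * ((ν : ℝ) + cosSum χ) * -(kernelSymbol (twoPtWR 1 W₀) χ).re) := by ring
      _ ≤ (2 * (1 : ℕ) : ℝ) ^ 2 / Z * (1 / (1 : ℕ) * Z) := mul_le_mul_of_nonneg_left h2 hc.le
      _ = 4 := hkey

/-! ### The `N = 1` conjunct of `SalmhoferSeilerSmallBeta`, granted the lattice symmetries -/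

/-- **CHIRAL LONG-RANGE ORDER FOR COMPACT LATTICE QED WITH ONE STAGGERED FERMION AT SMALL `β > 0`,
UNIFORMLY IN THE VOLUME** — the `N = 1` conjunct of the typed conjecture `SalmhoferSeilerSmallBeta`
(`ν ≥ 4`), granted the invariance of the meson moments `S_β(∏σ̂^m)` of the periodic theory under lattice
translations and axis transpositions (for every even `L`, every `0 ≤ β`, any ordering of the Grassmann
generators).  Inputs: `infraredBound_one` (row S3 at every `β`), `schwingerDysonBound_smallBeta` (row S4
at small `β`), `K(1) = 1`, `S(ν) < 7/20`. [cite: SalmhoferSeiler1991, Thm. 4.8 and Cor. 4.9 with (4.41)–(4.42), Remark 4.5] -/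
theorem chiralLRO_one_of_latticeSymmetric [NeZero ν] (hν : 4 ≤ ν)
    (hsym : ∀ (L : ℕ) [NeZero L] [LinearOrder (TorusSite ν L)] (β : ℝ), 0 ≤ β → Even L →
      (∀ (c : TorusSite ν L) (m : TorusSite ν L →₀ ℕ),
          mesonMoment 1 ν L β (Finsupp.mapDomain (Equiv.addRight c) m) = mesonMoment 1 ν L β m) ∧
      (∀ (i : Fin ν) (m : TorusSite ν L →₀ ℕ),
          mesonMoment 1 ν L β (Finsupp.mapDomain (axisSwap (L := L) i) m) = mesonMoment 1 ν L β m)) :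
    ∃ β₀ : ℝ, 0 < β₀ ∧ ∃ c : ℝ, 0 < c ∧ ∃ L₀ : ℕ, ∀ β : ℝ, 0 ≤ β → β < β₀ →
      ∀ (L : ℕ) [NeZero L], Even L → L₀ ≤ L → c ≤ ssChiralOrder 1 ν L β := by
  have hν3 : 3 ≤ ν := by omega
  have hν1 : 1 ≤ ν := by omega
  have hS := fluctS_lt_of_four_le hν
  have hA : (0 : ℝ) ≤ 4 := by norm_num
  have hAb : 2 * 4 * fluctS ν < 3 := by linarith
  obtain ⟨c, hc, L₁, hL₁⟩ := ComplexSpin.kernel_chiralLRO_uniform (ν := ν) hν3 hA hAb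
  obtain ⟨β₁, hβ₁, hSD⟩ := schwingerDysonBound_smallBeta (N := 1) (ν := ν) le_rfl (by norm_num) hν1 one_pos
  refine ⟨β₁, hβ₁, c, hc, L₁, fun β hβ hββ₁ L _ hE hLe => ?_⟩
  letI : LinearOrder (TorusSite ν L) :=
    LinearOrder.lift' (Fintype.equivFin (TorusSite ν L)) (Fintype.equivFin (TorusSite ν L)).injective
  obtain ⟨hT, hP⟩ := hsym L β hβ hE
  have hSD' : (3 : ℝ) ≤ ∑ μ : Fin ν, (ssTwoPoint 1 ν L β 0 0 (Pi.single μ 1) + ssTwoPoint 1 ν L β 0 0 (-Pi.single μ 1)) := by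
    have h := hSD β hβ hββ₁ L hE
    rw [ComplexSpin.sdK_uN_one] at h
    norm_num at h
    linarith
  have h := hL₁ L hE hLe (fun x y => ssTwoPoint 1 ν L β 0 x y)
    (fun x y a => ssTwoPoint_massless_add 1 ν L hE β x y a) (fun x y => ssTwoPoint_massless_comm 1 ν L β x y)
    (fun z hz => by
      refine ssTwoPoint_massless_eq_zero_of_sgn_eq 1 ν L hν1 hE.two_dvd β ?_
      rw [ComplexSpin.sgn_zero]
      unfold ComplexSpin.sgn
      rw [if_pos hz])
    (fun χ _ _ => infraredBound_one hE hβ hT hP χ)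
    hSD'
  unfold ssChiralOrder
  exact h

end MesonWeight

end Summit.Ventures.YMGap.Conjectures

end
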